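import Summits.NavierStokesRegularity.NavierStokesRegularity.Theorems.HodographBetchovClassBudgetsRegulariseAlgebra
import Summits.NavierStokesRegularity.NavierStokesRegularity.Theorems.HodographBetchovFastClassSqueezeDirectional

/-!
# Crux `HodographBetchov.FastClassSqueeze` — velocity-truncated enstrophy, pointwise algebra

Helper file for the crux item stmt-NavierStokesRegularity-15832 (`FastClassSqueeze`, route
`HodographBetchov` of `NavierStokesRegularity`): the pointwise `3 × 3` algebra behind the
VELOCITY-TRUNCATED enstrophy ledger (file `…FastClassSqueezeStreamStrainSlice.lean`), in which the
slow-class production is integrated by parts against the velocity cut-off `χ(‖v‖²)` and only a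
SHELL term `(v·ω) χ'(‖v‖²) ⟪v, ∇v ω⟫` and the Betchov fast term survive on the fast class.

* `apply_curl_eq_adjoint_apply_curl` — `∇v ω = (∇v)ᵀ ω` for `ω = curl v` (the spin part kills
  its own axis: `(∇v − ∇vᵀ) h = ω × h`);
* `inner_apply_curl_eq_inner_strain_apply` — hence `⟪w, ∇v ω⟫ = ⟪S w, ω⟫`, `S = ½(∇v + ∇vᵀ)`:
  the shell term sees only the STREAM-DIRECTIONAL STRAIN `S v̂`;
* `abs_inner_apply_curl_le` — `|⟪w, ∇v ω⟫| ≤ ‖S w‖ ‖ω‖`;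
* `two_frame_of_norm_strain_apply_le` — a bound `‖S v‖ ≤ m ‖v‖` at a point with `v ≠ 0` and
  `tr ∇v = 0` gives the crux's two-frame clause with majorant `m` (`λ₂(S) ≤ ‖S v̂‖`,
  `Directional.plane_form_le_norm_strain_apply`).

References: A. J. Majda, A. L. Bertozzi, *Vorticity and Incompressible Flow* (2002), §1.2,
(1.20)–(1.24); E. Miller, Arch. Ration. Mech. Anal. 235 (2020), Thm. 1.3.
-/

noncomputable section

open Set Function InnerProductSpace
open scoped RealInnerProductSpace

-- the summit and its single sub-problem share the name (CONVENTIONS §1), as in every Theorems file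
set_option linter.dupNamespace false

namespace Summit.NavierStokesRegularity.NavierStokesRegularity.Theorems.FastClassSqueeze.StreamStrain

open Literature.Analysis Literature.Analysis.FluidPDE
open Summit.NavierStokesRegularity.NavierStokesRegularity.Theorems.ClassBudgetsRegularise

/-- **The velocity gradient and its transpose agree on the vorticity**: `∇v(x) ω = ∇v(x)ᵀ ω` for
`ω = curl v x` — the antisymmetric part `∇v − ∇vᵀ` acts as `h ↦ ω × h` and kills `ω` itself.
Proof by coordinates. [cite: MajdaBertozziCUP2002, §1.2 eqs. (1.22)–(1.24)] -/
theorem apply_curl_eq_adjoint_apply_curl (v : EuclideanSpace ℝ (Fin 3) → EuclideanSpace ℝ (Fin 3))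
    (x : EuclideanSpace ℝ (Fin 3)) :
    fderiv ℝ v x (curl v x) = ContinuousLinearMap.adjoint (fderiv ℝ v x) (curl v x) := by
  set A := fderiv ℝ v x with hA
  obtain ⟨hc0, hc1, hc2⟩ := curl_apply_eq v x
  rw [← hA] at hc0 hc1 hc2
  ext i
  rw [apply_coord A (curl v x) i, apply_coord (ContinuousLinearMap.adjoint A) (curl v x) i]
  simp only [Fin.sum_univ_three, adjoint_entry, hc0, hc1, hc2]
  fin_cases i <;> simp <;> ring

/-- **The shell term sees only the stream-directional strain**: `⟪w, ∇v(x) ω⟫ = ⟪S w, ω⟫` for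
`ω = curl v x`, `S = ½(∇v(x) + ∇v(x)ᵀ)` and every `w` (by `apply_curl_eq_adjoint_apply_curl`,
`⟪w, Aω⟫ = ½⟪w, Aω⟫ + ½⟪w, Aᵀω⟫ = ⟪Sw, ω⟫`). [cite: MajdaBertozziCUP2002, §1.2 eqs. (1.22)–(1.24)] -/
theorem inner_apply_curl_eq_inner_strain_apply
    (v : EuclideanSpace ℝ (Fin 3) → EuclideanSpace ℝ (Fin 3)) (x w : EuclideanSpace ℝ (Fin 3)) :
    ⟪w, fderiv ℝ v x (curl v x)⟫ =
      ⟪((1 / 2 : ℝ) • (fderiv ℝ v x + ContinuousLinearMap.adjoint (fderiv ℝ v x))) w, curl v x⟫ := by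
  set A := fderiv ℝ v x with hA
  have h1 : ⟪w, A (curl v x)⟫ = ⟪ContinuousLinearMap.adjoint A w, curl v x⟫ := by
    rw [ContinuousLinearMap.adjoint_inner_left]
  have h2 : ⟪w, A (curl v x)⟫ = ⟪A w, curl v x⟫ := by
    rw [apply_curl_eq_adjoint_apply_curl, ContinuousLinearMap.adjoint_inner_right]
  rw [smul_apply, add_apply, inner_smul_left, inner_add_left, ← h1, ← h2]
  simp only [conj_trivial]
  ring

/-- `|⟪w, ∇v(x) ω⟫| ≤ ‖S w‖ ‖ω‖` for `ω = curl v x` (Cauchy–Schwarz after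
`inner_apply_curl_eq_inner_strain_apply`). [folklore] -/
theorem abs_inner_apply_curl_le
    (v : EuclideanSpace ℝ (Fin 3) → EuclideanSpace ℝ (Fin 3)) (x w : EuclideanSpace ℝ (Fin 3)) :
    |⟪w, fderiv ℝ v x (curl v x)⟫| ≤
      ‖((1 / 2 : ℝ) • (fderiv ℝ v x + ContinuousLinearMap.adjoint (fderiv ℝ v x))) w‖ *
        ‖curl v x‖ := by
  rw [inner_apply_curl_eq_inner_strain_apply]
  exact abs_real_inner_le_norm _ _

/-- **A stream-directional strain bound gives the two-frame clause.** At a point where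
`tr ∇v(x) = 0`, `v(x) ≠ 0` and `‖S v(x)‖ ≤ m ‖v(x)‖` (`S = ½(∇v + ∇vᵀ)`), the quadratic form of
`∇v(x)` is `≤ m (α² + β²)` on some orthonormal 2-frame: the middle strain eigenvalue is at most
`‖S ξ‖` for the unit vector `ξ = v/‖v‖` (`Directional.plane_form_le_norm_strain_apply`).
[cite: Miller2019, Thm 1.3] -/
theorem two_frame_of_norm_strain_apply_le
    {v : EuclideanSpace ℝ (Fin 3) → EuclideanSpace ℝ (Fin 3)} {x : EuclideanSpace ℝ (Fin 3)}
    (htr : LinearMap.trace ℝ (EuclideanSpace ℝ (Fin 3))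
      (fderiv ℝ v x : EuclideanSpace ℝ (Fin 3) →ₗ[ℝ] EuclideanSpace ℝ (Fin 3)) = 0)
    (hv : v x ≠ 0) {m : ℝ}
    (hm : ‖((1 / 2 : ℝ) • (fderiv ℝ v x + ContinuousLinearMap.adjoint (fderiv ℝ v x))) (v x)‖ ≤
      m * ‖v x‖) :
    ∃ a b : EuclideanSpace ℝ (Fin 3), ‖a‖ = 1 ∧ ‖b‖ = 1 ∧ ⟪a, b⟫ = 0 ∧
      ∀ α β : ℝ, ⟪fderiv ℝ v x (α • a + β • b), α • a + β • b⟫ ≤ m * (α ^ 2 + β ^ 2) := by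
  set A := fderiv ℝ v x with hA
  set S := (1 / 2 : ℝ) • (A + ContinuousLinearMap.adjoint A) with hS
  have hvpos : 0 < ‖v x‖ := norm_pos_iff.2 hv
  set ξ : EuclideanSpace ℝ (Fin 3) := ‖v x‖⁻¹ • v x with hξ
  have hξ1 : ‖ξ‖ = 1 := by
    rw [hξ, norm_smul, norm_inv, norm_norm, inv_mul_cancel₀ hvpos.ne']
  have hSξ : ‖S ξ‖ ≤ m := by
    rw [hξ, map_smul, norm_smul, norm_inv, norm_norm]
    rw [inv_mul_le_iff₀ hvpos]
    simpa [hS, mul_comm] using hm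
  obtain ⟨a, b, ha, hb, hab, h⟩ := Directional.plane_form_le_norm_strain_apply A htr hξ1
  refine ⟨a, b, ha, hb, hab, fun α β => (h α β).trans ?_⟩
  exact mul_le_mul_of_nonneg_right hSξ (by positivity)

/-- **Registered helper-stub form** of `apply_curl_eq_adjoint_apply_curl` (`∀`-closed):
`∇v(x) ω = ∇v(x)ᵀ ω`, `ω = curl v x`. [cite: MajdaBertozziCUP2002, §1.2 eqs. (1.22)–(1.24)] -/
theorem vorticity_fixed_by_transpose :
    ∀ (v : EuclideanSpace ℝ (Fin 3) → EuclideanSpace ℝ (Fin 3)) (x : EuclideanSpace ℝ (Fin 3)),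
      fderiv ℝ v x (Literature.Analysis.FluidPDE.curl v x) =
        ContinuousLinearMap.adjoint (fderiv ℝ v x) (Literature.Analysis.FluidPDE.curl v x) :=
  apply_curl_eq_adjoint_apply_curl

end Summit.NavierStokesRegularity.NavierStokesRegularity.Theorems.FastClassSqueeze.StreamStrain

end
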